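import Summits.ResolutionOfSingularities.ResolutionOfSingularities.Theorems.DeltaCutGradeCertificates3
import HarnessLib

/-!
# DeltaCutGradeCertificates4 — decomp-res node «GradeCut (certificates)» (lens-6 g28, critic row 210 CLEARED), tree
file 4/5 of the node

Content VERBATIM from the decomp-res lens-6 g28 certificate files
`HOME/decomp-res-lens-6/g28/GradeCutCertificates.lean` (92912ba2) + `GradeCutCertificates2.lean` (5886ffab) (ring
level, import the landed `DeltaCutRefCertificates3`; namespace `…Theorems.DeltaCutClasses`, sections
`GCertificatesA/B/C`); HOME = run/shared/lean/pub/decomp-res; critic CRITIC-LEDGER row 210 CLEARED; landing orders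
NEXT-g29.md §4 (B)/(C) + INBOX 11:01:55Z — provenance, critic text and the first lens header in full in
`DeltaCutGradeCertificates`.  `--kind proof --supports stmt-ResolutionOfSingularities-26971`.

## This file

Continuation 4/5 of `DeltaCutGradeCertificates` (same namespace / sections of the node, cut at the tree's 400-line
cap; section variables / opens replayed): scopes `GCertificatesC` — carries `G0_Bu_top`, `G0_Bu_lines`,
`G0_Cu_lineCharts`, `G0_Cu_chart_z_noTop`, `G0_Cu_chart_w_noTop`, `G0_Cu_chart_t_top`, `G0_Cu_chart_t_tame`,
`G0_Cw_lineCharts`, `G0_Cw_chart_t_top`, `G0_Cw_chart_t_tame`.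

[WRITER NOTE (decomp-res writer g13): file split only (tree files ≤ 400 lines, cut at declaration boundaries; the
two lens files form one linear chain); namespace, the sections `GCertificatesA/B/C` with their `open MvPolynomial` /
`variable {K : Type*} [Field K]`, and every declaration exactly as in the lens (the HOME-only dupNamespace-linter
lines are dropped — the library sets it; `noncomputable section`, the file-level `open` lines, `universe u` and
`open …Rescue.BedZpeBinom4Centre (mul_mem_pow_add)` are replayed in every part).]

(Sources: Hironaka1967; CossartJannsenSaito2020 Def. 3.13 / Thm. 3.14, Ch. 5–8; CossartPiltant2019 Prop. 2.6;
Giraud1975; EGAIV4 §16–§18; StacksProject 0804 / 0BIQ / 035A; Matsumura1987 §28–§31; Kollar2007 §3.)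
-/

noncomputable section

open CategoryTheory CategoryTheory.Limits AlgebraicGeometry TopologicalSpace IsLocalRing
open Literature.AlgebraicGeometry.Resolution

universe u

open Summit.ResolutionOfSingularities.ResolutionOfSingularities.Theorems.Rescue.BedZpeBinom4Centre (mul_mem_pow_add)

namespace Summit.ResolutionOfSingularities.ResolutionOfSingularities.Theorems.DeltaCutClasses

open Summit.ResolutionOfSingularities.ResolutionOfSingularities.Theorems.TwistCutClasses
open Summit.ResolutionOfSingularities.ResolutionOfSingularities.Theorems.LightCutClasses

section GCertificatesC

open MvPolynomial
variable {K : Type*} [Field K]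

/-! #### Step 1, chart `u`: `F₂ᵘ = z″³ + t·u·w″²` (coordinates `0 = z″, 1 = t, 2 = u, 3 = w″`; `V(u)` = the new
exceptional divisor) -/

/-- **STEP 1, chart `u` — THE TOP LOCUS lies in `M̃′ ∪ N₁`**, `M̃′ = V(z″,t,w″)`, `N₁ = V(z″,u,w″)`: a prime of
order `≥ 3` contains `w″`
(`∂_u∂_t F₂ᵘ = w″²`), `t` or `u` (`∂_w∂_w F₂ᵘ = 2t·u`), and `z″`. [new; elementary] [folklore] -/
theorem G0_Bu_top [CharP K 3] (𝔮 : Ideal (MvPolynomial (Fin 4) K)) [𝔮.IsPrime] {s : MvPolynomial (Fin 4) K} (hs : s ∉ 𝔮)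
    (h : s * (X 0 ^ 3 + X 1 * X 2 * X 3 ^ 2 : MvPolynomial (Fin 4) K) ∈ 𝔮 ^ 3) :
    (X 0 : MvPolynomial (Fin 4) K) ∈ 𝔮 ∧ (X 3 : MvPolynomial (Fin 4) K) ∈ 𝔮 ∧
      ((X 1 : MvPolynomial (Fin 4) K) ∈ 𝔮 ∨ (X 2 : MvPolynomial (Fin 4) K) ∈ 𝔮) := by
  have hP := ‹𝔮.IsPrime›
  have hs2 : s ^ 2 ∉ 𝔮 := pow_not_mem 𝔮 hs 2
  have hs4 : (s ^ 2) ^ 2 ∉ 𝔮 := pow_not_mem 𝔮 hs2 2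
  have h2 : (2 : MvPolynomial (Fin 4) K) ∉ 𝔮 := two_not_mem (K := K) 𝔮
  have e10 := f_ne K (i := 1) (j := 0) (by decide)
  have e11 := f_self K 1
  have e12 := f_ne K (i := 1) (j := 2) (by decide)
  have e13 := f_ne K (i := 1) (j := 3) (by decide)
  have e22 := f_self K 2
  have e23 := f_ne K (i := 2) (j := 3) (by decide)
  have e30 := f_ne K (i := 3) (j := 0) (by decide)
  have e31 := f_ne K (i := 3) (j := 1) (by decide)
  have e32 := f_ne K (i := 3) (j := 2) (by decide)
  have e33 := f_self K 3
  have d1 : pderiv 1 (X 0 ^ 3 + X 1 * X 2 * X 3 ^ 2 : MvPolynomial (Fin 4) K) = X 2 * X 3 ^ 2 := by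
    simp only [map_add, Derivation.leibniz, Derivation.leibniz_pow, smul_eq_mul, nsmul_eq_mul, e10, e11, e12, e13]
    push_cast; ring
  have d12 : pderiv 2 (X 2 * X 3 ^ 2 : MvPolynomial (Fin 4) K) = 1 * X 3 ^ 2 := by
    simp only [Derivation.leibniz, Derivation.leibniz_pow, smul_eq_mul, nsmul_eq_mul, e22, e23]
    push_cast; ring
  have d3 : pderiv 3 (X 0 ^ 3 + X 1 * X 2 * X 3 ^ 2 : MvPolynomial (Fin 4) K) = 2 * (X 1 * X 2 * X 3) := by
    simp only [map_add, Derivation.leibniz, Derivation.leibniz_pow, smul_eq_mul, nsmul_eq_mul, e30, e31, e32, e33]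
    push_cast; ring
  have dd3 : pderiv 3 (2 * (X 1 * X 2 * X 3) : MvPolynomial (Fin 4) K) = 2 * (X 1 * X 2) ^ 1 := by
    simp only [Derivation.leibniz, smul_eq_mul, e31, e32, e33, f_two]; ring
  have h1 := sq_mul_deriv_mem_pow 𝔮 h (pderiv 1)
  rw [d1] at h1
  have h12 := sq_mul_deriv_mem_pow 𝔮 h1 (pderiv 2)
  rw [d12] at h12
  have hw : (X 3 : MvPolynomial (Fin 4) K) ∈ 𝔮 := mem_of_mul_mul_pow_mem_pow 𝔮 one_ne_zero hs4 (one_not_mem_of_isPrime 𝔮) h12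
  have h13 := sq_mul_deriv_mem_pow 𝔮 h (pderiv 3)
  rw [d3] at h13
  have h33 := sq_mul_deriv_mem_pow 𝔮 h13 (pderiv 3)
  rw [dd3] at h33
  have htu : (X 1 * X 2 : MvPolynomial (Fin 4) K) ∈ 𝔮 := mem_of_mul_mul_pow_mem_pow 𝔮 one_ne_zero hs4 h2 h33
  have hf : (X 0 ^ 3 + X 1 * X 2 * X 3 ^ 2 : MvPolynomial (Fin 4) K) ∈ 𝔮 := mem_of_sMul_mem_cube 𝔮 hs h
  have hr : (X 1 * X 2 * X 3 ^ 2 : MvPolynomial (Fin 4) K) ∈ 𝔮 := Ideal.mul_mem_left _ _ (Ideal.pow_mem_of_mem 𝔮 hw 2 (by norm_num))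
  have h0 : (X 0 : MvPolynomial (Fin 4) K) ^ 3 ∈ 𝔮 := by
    have := Ideal.sub_mem _ hf hr
    rwa [add_sub_cancel_right] at this
  exact ⟨hP.mem_of_pow_mem 3 h0, hw, hP.mem_or_mem htu⟩

/-- **STEP 1, chart `u` — THE LINES `M̃′ = V(z″,t,w″)` (strict transform of `M′`) AND `N₁ = V(z″,u,w″)` (the
`t`-line of the exceptional
divisor) lie in the top locus** (`F₂ᵘ ∈ M̃′³`, `F₂ᵘ ∈ N₁³`), are LINES (`u ∉ M̃′`, `t ∉ N₁`), and meet at the origin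
of the chart only
(`M̃′ ⊔ N₁ = 𝔫₀`); `w″ ∈ 𝓘(M̃′)` and `z″ ∈ 𝓘(M̃′)`: `M̃′ ⊆ V(w″) ∩ V(z″)` MISSES the overlaps `D(w″)` with chart `w`
and `D(z″)` with chart
`z'` — with `G0_L1_symm`, the strict transforms `M̃` (chart `w` only) and `M̃′` (chart `u` only) are DISJOINT
coordinate lines: the step-2
centre `M̃ ⊔ M̃′` is REGULAR (R), `OldTopRegular`. [new; elementary] [folklore] -/
theorem G0_Bu_lines :
    (X 0 ^ 3 + X 1 * X 2 * X 3 ^ 2 : MvPolynomial (Fin 4) K) ∈ (Ideal.span {(X 0 : MvPolynomial (Fin 4) K), X 1, X 3}) ^ 3 ∧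
      (X 0 ^ 3 + X 1 * X 2 * X 3 ^ 2 : MvPolynomial (Fin 4) K) ∈ (Ideal.span {(X 0 : MvPolynomial (Fin 4) K), X 2, X 3}) ^ 3 ∧
      (X 2 : MvPolynomial (Fin 4) K) ∉ Ideal.span {(X 0 : MvPolynomial (Fin 4) K), X 1, X 3} ∧
      (X 1 : MvPolynomial (Fin 4) K) ∉ Ideal.span {(X 0 : MvPolynomial (Fin 4) K), X 2, X 3} ∧
      Ideal.span {(X 0 : MvPolynomial (Fin 4) K), X 1, X 3} ⊔ Ideal.span {(X 0 : MvPolynomial (Fin 4) K), X 2, X 3} =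
        Ideal.span {(X 0 : MvPolynomial (Fin 4) K), X 1, X 2, X 3} ∧
      ((X 3 : MvPolynomial (Fin 4) K) ∈ Ideal.span {(X 0 : MvPolynomial (Fin 4) K), X 1, X 3} ∧
        (X 0 : MvPolynomial (Fin 4) K) ∈ Ideal.span {(X 0 : MvPolynomial (Fin 4) K), X 1, X 3}) := by
  have hM0 : (X 0 : MvPolynomial (Fin 4) K) ∈ Ideal.span {(X 0 : MvPolynomial (Fin 4) K), X 1, X 3} := Ideal.subset_span (by simp)
  have hM1 : (X 1 : MvPolynomial (Fin 4) K) ∈ Ideal.span {(X 0 : MvPolynomial (Fin 4) K), X 1, X 3} := Ideal.subset_span (by simp)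
  have hM3 : (X 3 : MvPolynomial (Fin 4) K) ∈ Ideal.span {(X 0 : MvPolynomial (Fin 4) K), X 1, X 3} := Ideal.subset_span (by simp)
  have hN0 : (X 0 : MvPolynomial (Fin 4) K) ∈ Ideal.span {(X 0 : MvPolynomial (Fin 4) K), X 2, X 3} := Ideal.subset_span (by simp)
  have hN2 : (X 2 : MvPolynomial (Fin 4) K) ∈ Ideal.span {(X 0 : MvPolynomial (Fin 4) K), X 2, X 3} := Ideal.subset_span (by simp)
  have hN3 : (X 3 : MvPolynomial (Fin 4) K) ∈ Ideal.span {(X 0 : MvPolynomial (Fin 4) K), X 2, X 3} := Ideal.subset_span (by simp)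
  refine ⟨?_, ?_, ?_, ?_, ?_, hM3, hM0⟩
  · refine Ideal.add_mem _ (Ideal.pow_mem_pow hM0 3) ?_
    have h1 : (X 1 * X 2 : MvPolynomial (Fin 4) K) ∈ (Ideal.span {(X 0 : MvPolynomial (Fin 4) K), X 1, X 3}) ^ 1 := by
      rw [pow_one]; exact Ideal.mul_mem_right _ _ hM1
    exact mul_mem_pow_add h1 (Ideal.pow_mem_pow hM3 2)
  · refine Ideal.add_mem _ (Ideal.pow_mem_pow hN0 3) ?_
    have h1 : (X 1 * X 2 : MvPolynomial (Fin 4) K) ∈ (Ideal.span {(X 0 : MvPolynomial (Fin 4) K), X 2, X 3}) ^ 1 := by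
      rw [pow_one]; exact Ideal.mul_mem_left _ _ hN2
    exact mul_mem_pow_add h1 (Ideal.pow_mem_pow hN3 2)
  · refine not_mem_span_of_eval _ (fun i => if i = 2 then 1 else 0) ?_ (by simp)
    intro g hg
    simp only [Set.mem_insert_iff, Set.mem_singleton_iff] at hg
    rcases hg with rfl | rfl | rfl <;> simp
  · refine not_mem_span_of_eval _ (fun i => if i = 1 then 1 else 0) ?_ (by simp)
    intro g hg
    simp only [Set.mem_insert_iff, Set.mem_singleton_iff] at hg
    rcases hg with rfl | rfl | rfl <;> simp
  · apply le_antisymm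
    · refine sup_le (Ideal.span_le.2 ?_) (Ideal.span_le.2 ?_)
      · intro g hg
        simp only [Set.mem_insert_iff, Set.mem_singleton_iff] at hg
        rcases hg with rfl | rfl | rfl
        exacts [X_mem_spanX4 0, X_mem_spanX4 1, X_mem_spanX4 3]
      · intro g hg
        simp only [Set.mem_insert_iff, Set.mem_singleton_iff] at hg
        rcases hg with rfl | rfl | rfl
        exacts [X_mem_spanX4 0, X_mem_spanX4 2, X_mem_spanX4 3]
    · refine Ideal.span_le.2 ?_
      intro g hg
      simp only [Set.mem_insert_iff, Set.mem_singleton_iff] at hg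
      rcases hg with rfl | rfl | rfl | rfl
      · exact Ideal.mem_sup_left hM0
      · exact Ideal.mem_sup_left hM1
      · exact Ideal.mem_sup_right hN2
      · exact Ideal.mem_sup_left hM3

/-! #### Step 1, chart `w`: `F₂ʷ = z″³ + t·u″²·w` IS g26's P∞ (`X 0 ^ 3 + X 1 * X 2 ^ 2 * X 3`): top `⊆ V(z″,u″) ∩
(V(t) ∪ V(w)) = M̃ ∪ N₁`
(`Pinf_top`), `M̃ = V(z″,t,u″)` = P∞'s `w`-axis and `N₁ = V(z″,u″,w)` = P∞'s `s`-axis in the top locus (`Pinf_mem_cube_wAxis`,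
`Pinf_mem_cube_sAxis`), both LINES (`Pinf_axes_nondegenerate`) — cited BY NAME in `G0_G2a_certificate`; `u″, z″ ∈
𝓘(M̃)`: `M̃` misses the
charts `u` and `z'`.  (P∞ is g26's PERPETUAL inhabitant under ITS OWN hop — blow up the origin —; here the
polynomial sits at the
INTERMEDIATE stage of ONE separating hop whose step 2 blows up the whole old line `M̃` (order `3` along it:
permissible), after which no
bad point is left: `G0_Cw_chart_t_tame`, `Pinf_L1_lineChart_X0_noTop`, `Pinf_L1_lineChart_X2_noTop`.) -/

/-! #### Step 2 in chart `u`: centre `M̃′ = V(z″,t,w″)`, `linChartSubst {0,1,3} e` -/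

/-- **STEP 2, chart `u` — THE THREE REES CHARTS of the blow-up of `M̃′ = V(z″,t,w″)`**: chart `t`: `F₂ᵘ = t³·(z‴³ +
u·w‴²)`; chart `z″`:
`F₂ᵘ = z″³·(1 + t'·u·w‴²)`; chart `w″`: `F₂ᵘ = w″³·(z‴³ + t'·u)`. [new; elementary] [folklore] -/
theorem G0_Cu_lineCharts :
    aeval (linChartSubst (K := K) {0, 1, 3} 1) (X 0 ^ 3 + X 1 * X 2 * X 3 ^ 2 : MvPolynomial (Fin 4) K) =
        X 1 ^ 3 * (X 0 ^ 3 + X 2 * X 3 ^ 2) ∧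
      aeval (linChartSubst (K := K) {0, 1, 3} 0) (X 0 ^ 3 + X 1 * X 2 * X 3 ^ 2 : MvPolynomial (Fin 4) K) =
        X 0 ^ 3 * (1 + X 1 * X 2 * X 3 ^ 2) ∧
      aeval (linChartSubst (K := K) {0, 1, 3} 3) (X 0 ^ 3 + X 1 * X 2 * X 3 ^ 2 : MvPolynomial (Fin 4) K) =
        X 3 ^ 3 * (X 0 ^ 3 + X 1 * X 2) := by
  refine ⟨?_, ?_, ?_⟩ <;> (simp [linChartSubst]; ring)

/-- **STEP 2, chart `u` then `z″` — NO top point**: `1 + t'·u·w‴²` (`∂_{t'}` gives `u·w‴² ∈ 𝔮`, then `1 ∈ 𝔮`). [new;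
elementary] [folklore] -/
theorem G0_Cu_chart_z_noTop (𝔮 : Ideal (MvPolynomial (Fin 4) K)) [𝔮.IsPrime] {s : MvPolynomial (Fin 4) K} (hs : s ∉ 𝔮)
    (h : s * (1 + X 1 * X 2 * X 3 ^ 2 : MvPolynomial (Fin 4) K) ∈ 𝔮 ^ 3) : False := by
  have hs2 : s ^ 2 ∉ 𝔮 := pow_not_mem 𝔮 hs 2
  have e11 := f_self K 1
  have e12 := f_ne K (i := 1) (j := 2) (by decide)
  have e13 := f_ne K (i := 1) (j := 3) (by decide)
  have d1 : pderiv 1 (1 + X 1 * X 2 * X 3 ^ 2 : MvPolynomial (Fin 4) K) = X 2 * X 3 ^ 2 := by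
    simp only [map_add, Derivation.leibniz, Derivation.leibniz_pow, smul_eq_mul, nsmul_eq_mul, e11, e12, e13, f_one]
    push_cast; ring
  have h1 := sq_mul_deriv_mem_pow 𝔮 h (pderiv 1)
  rw [d1] at h1
  have hm : (X 2 * X 3 ^ 2 : MvPolynomial (Fin 4) K) ∈ 𝔮 :=
    (‹𝔮.IsPrime›.mem_or_mem (Ideal.pow_le_self two_ne_zero h1)).resolve_left hs2
  have hf : (1 + X 1 * X 2 * X 3 ^ 2 : MvPolynomial (Fin 4) K) ∈ 𝔮 := mem_of_sMul_mem_cube 𝔮 hs h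
  have h1mem : (1 : MvPolynomial (Fin 4) K) ∈ 𝔮 := by
    have := Ideal.sub_mem _ hf (Ideal.mul_mem_left _ (X 1) hm)
    rwa [show (1 + X 1 * X 2 * X 3 ^ 2 - X 1 * (X 2 * X 3 ^ 2) : MvPolynomial (Fin 4) K) = 1 by ring] at this
  exact one_not_mem_of_isPrime 𝔮 h1mem

/-- **STEP 2, chart `u` then `w″` — NO top point**: `z‴³ + t'·u` (`∂_{t'}` then `∂_u`: `s⁴ ∈ 𝔮` for the order
witness `s`). [new;
elementary] [folklore] -/
theorem G0_Cu_chart_w_noTop (𝔮 : Ideal (MvPolynomial (Fin 4) K)) [𝔮.IsPrime] {s : MvPolynomial (Fin 4) K} (hs : s ∉ 𝔮)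
    (h : s * (X 0 ^ 3 + X 1 * X 2 : MvPolynomial (Fin 4) K) ∈ 𝔮 ^ 3) : False := by
  have hs2 : s ^ 2 ∉ 𝔮 := pow_not_mem 𝔮 hs 2
  have hs4 : (s ^ 2) ^ 2 ∉ 𝔮 := pow_not_mem 𝔮 hs2 2
  have e10 := f_ne K (i := 1) (j := 0) (by decide)
  have e11 := f_self K 1
  have e12 := f_ne K (i := 1) (j := 2) (by decide)
  have e22 := f_self K 2
  have d1 : pderiv 1 (X 0 ^ 3 + X 1 * X 2 : MvPolynomial (Fin 4) K) = X 2 := by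
    simp only [map_add, Derivation.leibniz, Derivation.leibniz_pow, smul_eq_mul, nsmul_eq_mul, e10, e11, e12]
    push_cast; ring
  have h1 := sq_mul_deriv_mem_pow 𝔮 h (pderiv 1)
  rw [d1] at h1
  have h12 := sq_mul_deriv_mem_pow 𝔮 h1 (pderiv 2)
  rw [e22, mul_one, pow_one] at h12
  exact hs4 h12

/-- **STEP 2, chart `u` then `t` — THE TOP LOCUS IS THE LINE `Ñ₁ = V(z‴, u, w‴)`** (`⊆`: a prime of order `≥ 3` of
`z‴³ + u·w‴²` contains
`w‴` (`∂_u`), `u` (`∂_w∂_w = 2u`) and `z‴`; `⊇`: `u·w‴² ∈ Ñ₁³`). [new; elementary] [folklore] -/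
theorem G0_Cu_chart_t_top [CharP K 3] (𝔮 : Ideal (MvPolynomial (Fin 4) K)) [𝔮.IsPrime] {s : MvPolynomial (Fin 4) K} (hs : s ∉ 𝔮)
    (h : s * (X 0 ^ 3 + X 2 * X 3 ^ 2 : MvPolynomial (Fin 4) K) ∈ 𝔮 ^ 3) :
    ((X 0 : MvPolynomial (Fin 4) K) ∈ 𝔮 ∧ (X 2 : MvPolynomial (Fin 4) K) ∈ 𝔮 ∧ (X 3 : MvPolynomial (Fin 4) K) ∈ 𝔮) ∧
      (X 0 ^ 3 + X 2 * X 3 ^ 2 : MvPolynomial (Fin 4) K) ∈ (Ideal.span {(X 0 : MvPolynomial (Fin 4) K), X 2, X 3}) ^ 3 := by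
  have hP := ‹𝔮.IsPrime›
  have hs2 : s ^ 2 ∉ 𝔮 := pow_not_mem 𝔮 hs 2
  have hs4 : (s ^ 2) ^ 2 ∉ 𝔮 := pow_not_mem 𝔮 hs2 2
  have h2 : (2 : MvPolynomial (Fin 4) K) ∉ 𝔮 := two_not_mem (K := K) 𝔮
  have e20 := f_ne K (i := 2) (j := 0) (by decide)
  have e22 := f_self K 2
  have e23 := f_ne K (i := 2) (j := 3) (by decide)
  have e30 := f_ne K (i := 3) (j := 0) (by decide)
  have e32 := f_ne K (i := 3) (j := 2) (by decide)
  have e33 := f_self K 3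
  have d2 : pderiv 2 (X 0 ^ 3 + X 2 * X 3 ^ 2 : MvPolynomial (Fin 4) K) = 1 * X 3 ^ 2 := by
    simp only [map_add, Derivation.leibniz, Derivation.leibniz_pow, smul_eq_mul, nsmul_eq_mul, e20, e22, e23]
    push_cast; ring
  have d3 : pderiv 3 (X 0 ^ 3 + X 2 * X 3 ^ 2 : MvPolynomial (Fin 4) K) = 2 * (X 2 * X 3) := by
    simp only [map_add, Derivation.leibniz, Derivation.leibniz_pow, smul_eq_mul, nsmul_eq_mul, e30, e32, e33]
    push_cast; ring
  have dd3 : pderiv 3 (2 * (X 2 * X 3) : MvPolynomial (Fin 4) K) = 2 * X 2 ^ 1 := by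
    simp only [Derivation.leibniz, smul_eq_mul, e32, e33, f_two]; ring
  have h12 := sq_mul_deriv_mem_pow 𝔮 h (pderiv 2)
  rw [d2] at h12
  have hw : (X 3 : MvPolynomial (Fin 4) K) ∈ 𝔮 := mem_of_mul_mul_pow_mem_pow 𝔮 two_ne_zero hs2 (one_not_mem_of_isPrime 𝔮) h12
  have h13 := sq_mul_deriv_mem_pow 𝔮 h (pderiv 3)
  rw [d3] at h13
  have h33 := sq_mul_deriv_mem_pow 𝔮 h13 (pderiv 3)
  rw [dd3] at h33
  have hu : (X 2 : MvPolynomial (Fin 4) K) ∈ 𝔮 := mem_of_mul_mul_pow_mem_pow 𝔮 one_ne_zero hs4 h2 h33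
  have hf : (X 0 ^ 3 + X 2 * X 3 ^ 2 : MvPolynomial (Fin 4) K) ∈ 𝔮 := mem_of_sMul_mem_cube 𝔮 hs h
  have h0 : (X 0 : MvPolynomial (Fin 4) K) ^ 3 ∈ 𝔮 := by
    have := Ideal.sub_mem _ hf (Ideal.mul_mem_left _ (X 2) (Ideal.pow_mem_of_mem 𝔮 hw 2 (by norm_num)))
    rwa [add_sub_cancel_right] at this
  have hN0 : (X 0 : MvPolynomial (Fin 4) K) ∈ Ideal.span {(X 0 : MvPolynomial (Fin 4) K), X 2, X 3} := Ideal.subset_span (by simp)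
  have hN2 : (X 2 : MvPolynomial (Fin 4) K) ∈ Ideal.span {(X 0 : MvPolynomial (Fin 4) K), X 2, X 3} := Ideal.subset_span (by simp)
  have hN3 : (X 3 : MvPolynomial (Fin 4) K) ∈ Ideal.span {(X 0 : MvPolynomial (Fin 4) K), X 2, X 3} := Ideal.subset_span (by simp)
  refine ⟨⟨hP.mem_of_pow_mem 3 h0, hu, hw⟩, Ideal.add_mem _ (Ideal.pow_mem_pow hN0 3) ?_⟩
  exact mul_mem_pow_add (m := 1) (n := 2) (by rw [pow_one]; exact hN2) (Ideal.pow_mem_pow hN3 2)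

/-- **STEP 2, chart `u` then `t` — TAME AT EVERY TOP POINT** (so NO bad point in this chart): at any prime `𝔫 ∋ u`
the order-2 operator
`∂_w∂_w` extracts `∂_w∂_w (z‴³ + u·w‴²) = 2·u`, and `u` is a REGULAR PARAMETER (`s'·u ∉ 𝔫²` for `s' ∉ 𝔫`; `2` is a unit in
characteristic `3`). [new; elementary] [folklore] -/
theorem G0_Cu_chart_t_tame (𝔫 : Ideal (MvPolynomial (Fin 4) K)) [𝔫.IsPrime] (hu : (X 2 : MvPolynomial (Fin 4) K) ∈ 𝔫) :
    (pderiv 3) ((pderiv 3) (X 0 ^ 3 + X 2 * X 3 ^ 2 : MvPolynomial (Fin 4) K)) = 2 * X 2 ∧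
      ∀ s' ∉ 𝔫, s' * (X 2 : MvPolynomial (Fin 4) K) ∉ 𝔫 ^ 2 := by
  have e30 := f_ne K (i := 3) (j := 0) (by decide)
  have e32 := f_ne K (i := 3) (j := 2) (by decide)
  have e33 := f_self K 3
  have d3 : pderiv 3 (X 0 ^ 3 + X 2 * X 3 ^ 2 : MvPolynomial (Fin 4) K) = 2 * (X 2 * X 3) := by
    simp only [map_add, Derivation.leibniz, Derivation.leibniz_pow, smul_eq_mul, nsmul_eq_mul, e30, e32, e33]
    push_cast; ring
  have dd3 : pderiv 3 (2 * (X 2 * X 3) : MvPolynomial (Fin 4) K) = 2 * X 2 := by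
    simp only [Derivation.leibniz, smul_eq_mul, e32, e33, f_two]; ring
  exact ⟨by rw [d3, dd3], fun s' hs' hmem => sMul_not_mem_sq_of_pderiv_eq_one 𝔫 2 hu (f_self K 2) hs' hmem⟩

/-! #### Step 2 in chart `w`: centre `M̃ = V(z″,t,u″)`, `linChartSubst {0,1,2} e` -/

/-- **STEP 2, chart `w` — THE THREE REES CHARTS of the blow-up of `M̃ = V(z″,t,u″)`**: chart `t`: `F₂ʷ = t³·(z‴³ +
u‴²·w)`; chart `z″`:
`F₂ʷ = z″³·(1 + t'·u‴²·w)` (P∞'s `Pinf_L1_lineChart_X0_noTop` polynomial); chart `u″`: `F₂ʷ = u″³·(z‴³ + t'·w)` (P∞'s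
`Pinf_L1_lineChart_X2_noTop` polynomial). [new; elementary] [folklore] -/
theorem G0_Cw_lineCharts :
    aeval (linChartSubst (K := K) {0, 1, 2} 1) (X 0 ^ 3 + X 1 * X 2 ^ 2 * X 3 : MvPolynomial (Fin 4) K) =
        X 1 ^ 3 * (X 0 ^ 3 + X 2 ^ 2 * X 3) ∧
      aeval (linChartSubst (K := K) {0, 1, 2} 0) (X 0 ^ 3 + X 1 * X 2 ^ 2 * X 3 : MvPolynomial (Fin 4) K) =
        X 0 ^ 3 * (1 + X 1 * X 2 ^ 2 * X 3) ∧
      aeval (linChartSubst (K := K) {0, 1, 2} 2) (X 0 ^ 3 + X 1 * X 2 ^ 2 * X 3 : MvPolynomial (Fin 4) K) =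
        X 2 ^ 3 * (X 0 ^ 3 + X 1 * X 3) := by
  refine ⟨?_, ?_, ?_⟩ <;> (simp [linChartSubst]; ring)

/-- **STEP 2, chart `w` then `t` — THE TOP LOCUS IS THE LINE `Ñ₁ = V(z‴, u‴, w)`** (`⊆`: `u‴` by `∂_w`, `w` by
`∂_u∂_u = 2w`, `z‴`; `⊇`:
`u‴²·w ∈ Ñ₁³`). [new; elementary] [folklore] -/
theorem G0_Cw_chart_t_top [CharP K 3] (𝔮 : Ideal (MvPolynomial (Fin 4) K)) [𝔮.IsPrime] {s : MvPolynomial (Fin 4) K} (hs : s ∉ 𝔮)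
    (h : s * (X 0 ^ 3 + X 2 ^ 2 * X 3 : MvPolynomial (Fin 4) K) ∈ 𝔮 ^ 3) :
    ((X 0 : MvPolynomial (Fin 4) K) ∈ 𝔮 ∧ (X 2 : MvPolynomial (Fin 4) K) ∈ 𝔮 ∧ (X 3 : MvPolynomial (Fin 4) K) ∈ 𝔮) ∧
      (X 0 ^ 3 + X 2 ^ 2 * X 3 : MvPolynomial (Fin 4) K) ∈ (Ideal.span {(X 0 : MvPolynomial (Fin 4) K), X 2, X 3}) ^ 3 := by
  have hP := ‹𝔮.IsPrime›
  have hs2 : s ^ 2 ∉ 𝔮 := pow_not_mem 𝔮 hs 2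
  have hs4 : (s ^ 2) ^ 2 ∉ 𝔮 := pow_not_mem 𝔮 hs2 2
  have h2 : (2 : MvPolynomial (Fin 4) K) ∉ 𝔮 := two_not_mem (K := K) 𝔮
  have e20 := f_ne K (i := 2) (j := 0) (by decide)
  have e22 := f_self K 2
  have e23 := f_ne K (i := 2) (j := 3) (by decide)
  have e30 := f_ne K (i := 3) (j := 0) (by decide)
  have e32 := f_ne K (i := 3) (j := 2) (by decide)
  have e33 := f_self K 3
  have d3 : pderiv 3 (X 0 ^ 3 + X 2 ^ 2 * X 3 : MvPolynomial (Fin 4) K) = 1 * X 2 ^ 2 := by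
    simp only [map_add, Derivation.leibniz, Derivation.leibniz_pow, smul_eq_mul, nsmul_eq_mul, e30, e32, e33]
    push_cast; ring
  have d2 : pderiv 2 (X 0 ^ 3 + X 2 ^ 2 * X 3 : MvPolynomial (Fin 4) K) = 2 * (X 2 * X 3) := by
    simp only [map_add, Derivation.leibniz, Derivation.leibniz_pow, smul_eq_mul, nsmul_eq_mul, e20, e22, e23]
    push_cast; ring
  have dd2 : pderiv 2 (2 * (X 2 * X 3) : MvPolynomial (Fin 4) K) = 2 * X 3 ^ 1 := by
    simp only [Derivation.leibniz, smul_eq_mul, e22, e23, f_two]; ring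
  have h13 := sq_mul_deriv_mem_pow 𝔮 h (pderiv 3)
  rw [d3] at h13
  have hu : (X 2 : MvPolynomial (Fin 4) K) ∈ 𝔮 := mem_of_mul_mul_pow_mem_pow 𝔮 two_ne_zero hs2 (one_not_mem_of_isPrime 𝔮) h13
  have h12 := sq_mul_deriv_mem_pow 𝔮 h (pderiv 2)
  rw [d2] at h12
  have h22 := sq_mul_deriv_mem_pow 𝔮 h12 (pderiv 2)
  rw [dd2] at h22
  have hw : (X 3 : MvPolynomial (Fin 4) K) ∈ 𝔮 := mem_of_mul_mul_pow_mem_pow 𝔮 one_ne_zero hs4 h2 h22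
  have hf : (X 0 ^ 3 + X 2 ^ 2 * X 3 : MvPolynomial (Fin 4) K) ∈ 𝔮 := mem_of_sMul_mem_cube 𝔮 hs h
  have h0 : (X 0 : MvPolynomial (Fin 4) K) ^ 3 ∈ 𝔮 := by
    have := Ideal.sub_mem _ hf (Ideal.mul_mem_left _ (X 2 ^ 2) hw)
    rwa [add_sub_cancel_right] at this
  have hN0 : (X 0 : MvPolynomial (Fin 4) K) ∈ Ideal.span {(X 0 : MvPolynomial (Fin 4) K), X 2, X 3} := Ideal.subset_span (by simp)
  have hN2 : (X 2 : MvPolynomial (Fin 4) K) ∈ Ideal.span {(X 0 : MvPolynomial (Fin 4) K), X 2, X 3} := Ideal.subset_span (by simp)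
  have hN3 : (X 3 : MvPolynomial (Fin 4) K) ∈ Ideal.span {(X 0 : MvPolynomial (Fin 4) K), X 2, X 3} := Ideal.subset_span (by simp)
  refine ⟨⟨hP.mem_of_pow_mem 3 h0, hu, hw⟩, Ideal.add_mem _ (Ideal.pow_mem_pow hN0 3) ?_⟩
  exact mul_mem_pow_add (m := 2) (n := 1) (Ideal.pow_mem_pow hN2 2) (by rw [pow_one]; exact hN3)

/-- **STEP 2, chart `w` then `t` — TAME AT EVERY TOP POINT**: at any prime `𝔫 ∋ w`, `∂_u∂_u (z‴³ + u‴²·w) = 2·w` and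
`w` is a REGULAR
PARAMETER. [new; elementary] [folklore] -/
theorem G0_Cw_chart_t_tame (𝔫 : Ideal (MvPolynomial (Fin 4) K)) [𝔫.IsPrime] (hw : (X 3 : MvPolynomial (Fin 4) K) ∈ 𝔫) :
    (pderiv 2) ((pderiv 2) (X 0 ^ 3 + X 2 ^ 2 * X 3 : MvPolynomial (Fin 4) K)) = 2 * X 3 ∧
      ∀ s' ∉ 𝔫, s' * (X 3 : MvPolynomial (Fin 4) K) ∉ 𝔫 ^ 2 := by
  have e20 := f_ne K (i := 2) (j := 0) (by decide)
  have e22 := f_self K 2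
  have e23 := f_ne K (i := 2) (j := 3) (by decide)
  have d2 : pderiv 2 (X 0 ^ 3 + X 2 ^ 2 * X 3 : MvPolynomial (Fin 4) K) = 2 * (X 2 * X 3) := by
    simp only [map_add, Derivation.leibniz, Derivation.leibniz_pow, smul_eq_mul, nsmul_eq_mul, e20, e22, e23]
    push_cast; ring
  have dd2 : pderiv 2 (2 * (X 2 * X 3) : MvPolynomial (Fin 4) K) = 2 * X 3 := by
    simp only [Derivation.leibniz, smul_eq_mul, e22, e23, f_two]; ring
  exact ⟨by rw [d2, dd2], fun s' hs' hmem => sMul_not_mem_sq_of_pderiv_eq_one 𝔫 3 hw (f_self K 3) hs' hmem⟩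

end GCertificatesC

end Summit.ResolutionOfSingularities.ResolutionOfSingularities.Theorems.DeltaCutClasses
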